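import Literature.NumberTheory.EllipticCurves.Kato2004.IwasawaCohomologyNumberField
import Literature.NumberTheory.GaloisRepresentations.ContinuousCorestrictionDoubleCosetFinite
import Literature.NumberTheory.GaloisRepresentations.AbsGaloisOuterConj
import Literature.NumberTheory.GaloisRepresentations.AbsIntegersEquiv
import HarnessLib

/-!
# Kato 2004 §8.2: `H¹(O_F[1/p], T)` is stable under corestriction — the GENERAL case (any open level of
# finite index, ramification allowed), by the double-coset (Mackey) formula

Topic `NumberTheory/EllipticCurves/Kato2004` (about `Kato2004.integralH1` of `IwasawaCohomology.lean` and its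
`K`-twin `Kato2004.CM.integralH1K` of `EllipticZetaReciprocity.lean`).  Sequel of `IntegralH1Corestriction.lean`,
whose `coresLe_mem_integralH1` treats a NORMAL smaller level `V ⊴ Γ_ℚ` CONTAINING the inertia groups at every
`v ≠ p` (so that the restriction of `cor φ` to `U ∩ I_𝔓` is a plain sum of conjugates).  Seat `bsd-2adic-conv-1`
GEN 30 (cell `pub/bsd-2adic`, WANTED-CARRIER-K file D = the Shapiro corestriction
`𝐇¹_{K,Γ}(T_pW_K) → 𝐇¹_Γ(T_pW)`, whose smaller level `Gal(ℚ̄/K_n) ∩ Γ_{ℚ_n}` does NOT contain the inertia at the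
primes ramified in `K`).  PROOFS only; no definition, no named fact, no `sorry`.

Statement (`resLe_inertia_coresLe_eq_zero`, generic; `coresLe_mem_integralH1_of_le` over `ℚ`;
`coresLe_mem_integralH1K_of_le` over a number field `K`): for subgroups `V ≤ U` of `Γ` with `V` open of finite
index in `U` — `V` NOT assumed normal, NO unramifiedness —, `cor_{U/V}` maps `integralH1 T p V` into
`integralH1 T p U`.  Proof: by the VANISHING FORM of the double-coset formula already in the tree
(`resSubgroup_cores_eq_zero_of_doubleCoset`, file `GaloisRepresentations/ContinuousCorestrictionDoubleCoset.lean`: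
`res_D (cor y) = Σ_{D g V} cor ∘ (g)_* res_{V ∩ g⁻¹ D g} y`) with `D = U ∩ I_𝔓`: for a double-coset representative
`g ∈ U` the subgroup `V ∩ g⁻¹ (U ∩ I_𝔓) g` is `V ∩ I_{g⁻¹𝔓}` (`Ideal.conj_mem_inertia_smul_iff`), on which the class is
a coboundary `b ↦ b·w − w` by hypothesis (`g⁻¹𝔓` lies over the same place, `smul_mem_primesAbove`), and then the
conjugated restriction `a ↦ g·φ(g⁻¹ a g)` is the coboundary of `g·w`.  This is Kato §8.2 "`H^q(O_K[S⁻¹], T)` is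
functorial for the trace" / NSW (1.5.7) in full generality at class level.

References: K. Kato, Astérisque 295 (2004) §8.2, Lemma 8.5 (pp. 180–184) [Kato2004Asterisque]; J. Neukirch,
A. Schmidt, K. Wingberg (2008) I §5 (1.5.6)–(1.5.7) [NeukirchSchmidtWingberg2008]; tree:
`GaloisRepresentations/ContinuousCorestrictionDoubleCoset{,Finite}.lean`, `AbsGaloisOuterConj.lean`
(`Ideal.conj_mem_inertia_smul_iff`), `AbsIntegersEquiv.lean` (`smul_mem_primesAbove`).
-/

noncomputable section

open scoped NumberField Pointwise
open CategoryTheory Field IsDedekindDomain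
open Literature.NumberTheory.GaloisRepresentations Rat.HeightOneSpectrum
open Literature.NumberTheory.EllipticCurves (subgroupInclusion subgroupInclusion_apply_coe)
open Literature.NumberTheory.EllipticCurves.Kato2004.CM (integralH1K mem_integralH1K_iff)

namespace Literature.NumberTheory.EllipticCurves.Kato2004

universe u v

/-! ## §1 Generic: `res_{U ∩ I_𝔓} (cor_{U/V} x) = 0` as soon as `res_{V ∩ I_{g⁻¹𝔓}} x = 0` for all `g ∈ U` -/

section Generic

variable {R : Type u} [Ring R] [TopologicalSpace R]
  {G : Type v} [Group G] [TopologicalSpace G] [IsTopologicalGroup G]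
  {B : Type*} [CommRing B] [MulSemiringAction G B]

/-- Bridge between the two restrictions to a subgroup `D ≤ U`: if the restriction of a class of `H¹(U, X)` to
`D` viewed INSIDE `U` (`resSubgroup (X|U) (D.subgroupOf U)`) vanishes, then so does its restriction `resLe` to
`D ≤ U` viewed inside `G` (both say: the cocycle is `d ↦ d·w − w` on `D`). [cite: SerreGaloisCohomology1997, I §2.4] -/
theorem resLe_eq_zero_of_resSubgroup_subgroupOf_eq_zero (X : TopRep.{v} R G) {D U : Subgroup G} (hD : D ≤ U)
    {c : continuousCohomology 1 (subgroupRep X U)}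
    (hc : resSubgroup (subgroupRep X U) (D.subgroupOf U) 1 c = 0) :
    resLe X hD 1 c = 0 := by
  obtain ⟨ψ, rfl⟩ := oneCocycleClass_surjective _ c
  rw [resSubgroup_oneCocycleClass, oneCocycleClass_eq_zero_iff] at hc
  obtain ⟨w, hw⟩ := hc
  rw [resLe_oneCocycleClass, oneCocycleClass_eq_zero_iff]
  refine ⟨w, fun y ↦ ?_⟩
  have key : ψ.1 ⟨(y : G), hD y.2⟩ = X.ρ (y : G) w - w :=
    hw ⟨⟨(y : G), hD y.2⟩, Subgroup.mem_subgroupOf.mpr y.2⟩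
  have harg : subgroupInclusion hD y = ⟨(y : G), hD y.2⟩ := Subtype.ext rfl
  rw [contOneCocycles.pullback_apply, TopRep.hom_ofHom, harg]
  exact key

/-- **Corestriction preserves vanishing on inertia — general double-coset form.**  Let `V ≤ U` be subgroups of
a topological group `G` acting on a commutative ring `B` (e.g. `Γ_K` on `\bar ℤ_K`), `V` open of finite index in
`U`, `𝔓` an ideal of `B`, and `x ∈ H¹(V, X)` a class whose restriction to `V ∩ I_{g⁻¹𝔓}` vanishes for EVERY `g ∈ U`.
Then the restriction of `cor_{U/V} x` to `U ∩ I_𝔓` vanishes.  Proof: the vanishing form of the double-coset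
formula (`resSubgroup_cores_eq_zero_of_doubleCoset`) inside `U` with `D = U ∩ I_𝔓`; for a representative `g` of a
double coset `D g V`, `D ∩ g V g⁻¹` conjugates by `g⁻¹` into `V ∩ I_{g⁻¹𝔓}` (`Ideal.conj_mem_inertia_smul_iff`), where
the cocycle is `b ↦ b·w − w`, so `a ↦ g·φ(g⁻¹ a g) = a·(g·w) − g·w` is a coboundary.
[cite: NeukirchSchmidtWingberg2008, I §5 (1.5.6)–(1.5.7)] -/
theorem resLe_inertia_coresLe_eq_zero (X : TopRep.{v} R G) {V U : Subgroup G} (h : V ≤ U)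
    (hV : IsOpen (V : Set G)) [Fintype (U ⧸ V.subgroupOf U)] (𝔓 : Ideal B)
    {x : continuousCohomology 1 (subgroupRep X V)}
    (hx : ∀ g : G, g ∈ U → resLe X (inf_le_left : V ⊓ (g⁻¹ • 𝔓).inertia G ≤ V) 1 x = 0) :
    resLe X (inf_le_left : U ⊓ 𝔓.inertia G ≤ U) 1 (coresLe X h hV x) = 0 := by
  classical
  obtain ⟨φ, rfl⟩ := oneCocycleClass_surjective _ x
  -- everything inside `U`: `N = V`, `D = U ∩ I_𝔓` as subgroups of `U`
  let XU := subgroupRep X U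
  let N : Subgroup U := V.subgroupOf U
  let D : Subgroup U := (U ⊓ 𝔓.inertia G).subgroupOf U
  haveI : Finite (DoubleCoset.Quotient (D : Set U) N) := finite_doubleCosetQuotient N D
  letI : Fintype (DoubleCoset.Quotient (D : Set U) N) := Fintype.ofFinite _
  letI : ∀ q : DoubleCoset.Quotient (D : Set U) N, Fintype (D ⧸ (interConj N D q.out).subgroupOf D) :=
    fun q ↦ @Fintype.ofFinite _ (finite_quotient_interConj_subgroupOf N D q.out)
  -- representatives of `U ⧸ V`
  have hs : ∀ y : U ⧸ N, ((Quotient.out y : U) : U ⧸ N) = y := fun y ↦ QuotientGroup.out_eq' y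
  -- the pulled-back cocycle on `N = V.subgroupOf U`
  let φ' : contOneCocycles (subgroupRep XU N) :=
    contOneCocycles.pullback (subgroupOfHom h) (Y := subgroupRep XU N)
      (TopRep.ofHom ⟨ContinuousLinearMap.id R X, fun _ => rfl⟩) φ
  -- Mackey: `res_D (cor [φ']) = 0` inside `U`
  have hvan : resSubgroup XU D 1 (cores XU N (isOpen_subgroupOf U hV) (oneCocycleClass _ φ')) = 0 := by
    refine resSubgroup_cores_eq_zero_of_doubleCoset N D XU (isOpen_subgroupOf U hV) _ fun q ↦ ?_
    set g : U := q.out with hg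
    -- the hypothesis at the conjugate prime `g⁻¹ 𝔓`
    have h0 := hx (g : G) g.2
    rw [resLe_oneCocycleClass, oneCocycleClass_eq_zero_iff] at h0
    obtain ⟨w, hw⟩ := h0
    rw [conjRes_oneCocycleClass, oneCocycleClass_eq_zero_iff]
    refine ⟨X.ρ (g : G) w, fun a ↦ ?_⟩
    have ha := (mem_interConj N D (g : U) (a : U)).mp a.2
    have haI : ((a : U) : G) ∈ 𝔓.inertia G := (Subgroup.mem_subgroupOf.mp ha.1).2
    have hbV : (g : G)⁻¹ * ((a : U) : G) * (g : G) ∈ V := by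
      have h' := Subgroup.mem_subgroupOf.mp ha.2
      simpa only [Subgroup.coe_mul, Subgroup.coe_inv] using h'
    have hbI : (g : G)⁻¹ * ((a : U) : G) * (g : G) ∈ ((g : G)⁻¹ • 𝔓).inertia G := by
      have h' := (Ideal.conj_mem_inertia_smul_iff 𝔓 (g : G)⁻¹ ((a : U) : G)).mpr haI
      simpa using h'
    have key : φ.1 (subgroupInclusion inf_le_left ⟨(g : G)⁻¹ * ((a : U) : G) * (g : G), hbV, hbI⟩) =
        X.ρ ((g : G)⁻¹ * ((a : U) : G) * (g : G)) w - w :=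
      hw ⟨(g : G)⁻¹ * ((a : U) : G) * (g : G), hbV, hbI⟩
    have harg : subgroupOfHom h (conjResHom N (g : U) (interConj N D (g : U)) (fun _ ha ↦ ha.2) a) =
        subgroupInclusion inf_le_left ⟨(g : G)⁻¹ * ((a : U) : G) * (g : G), hbV, hbI⟩ := by
      apply Subtype.ext
      rw [subgroupOfHom_apply_coe, conjResHom_apply_coe, subgroupInclusion_apply_coe]
      simp only [Subgroup.coe_mul, Subgroup.coe_inv]
    rw [conjRes_pullback_apply]
    change X.ρ ((g : U) : G) (φ.1 (subgroupOfHom h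
        (conjResHom N (g : U) (interConj N D (g : U)) (fun _ ha ↦ ha.2) a))) =
      X.ρ ((a : U) : G) (X.ρ ((g : U) : G) w) - X.ρ ((g : U) : G) w
    rw [harg, key, map_sub, ← ρ_mul_apply, ← ρ_mul_apply]
    congr 2
    group
  -- back to `resLe`/`coresLe` inside `G`
  rw [coresLe_oneCocycleClass X h hV hs φ]
  rw [cores_oneCocycleClass _ _ _ hs] at hvan
  exact resLe_eq_zero_of_resSubgroup_subgroupOf_eq_zero X inf_le_left hvan

end Generic

/-! ## §2 Kato §8.2 over `ℚ` and over a number field: `cor_{U/V}` maps `H¹(ℤ_V[1/p], T)` into `H¹(ℤ_U[1/p], T)` -/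

section Integral

variable {A : Type} [CommRing A] [TopologicalSpace A] {M : Type} [AddCommGroup M] [Module A M]
  [TopologicalSpace M] [IsTopologicalAddGroup M] [ContinuousSMul A M]

/-- **Corestriction preserves the integral classes (general case), over `ℚ`.**  For subgroups `V ≤ U` of `Γ_ℚ`
with `V` open of finite index in `U` — `V` not assumed normal, and ALLOWED to omit the inertia groups (the fixed
field of `V` may ramify over that of `U` away from `p`) — `cor_{U/V}` maps `H¹(ℤ_V[1/p], T) = integralH1 T p V`
into `H¹(ℤ_U[1/p], T) = integralH1 T p U`: for `𝔓 ∣ v ≠ p` every conjugate `g⁻¹𝔓` (`g ∈ U`) lies over `v`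
(`smul_mem_primesAbove`), so the class vanishes on every `V ∩ I_{g⁻¹𝔓}` and `resLe_inertia_coresLe_eq_zero`
applies (Kato §8.2: `H¹(O_K[S⁻¹], T)` is functorial for the trace along `O_L[S⁻¹]/O_K[S⁻¹]`; NSW (1.5.7)).
Supersedes the normal unramified case `coresLe_mem_integralH1`. [cite: Kato2004Asterisque, §8.2 and Lemma 8.5 (pp. 180–184)] -/
theorem coresLe_mem_integralH1_of_le (T : GaloisRep ℚ A M) (p : ℕ)
    {V U : Subgroup (absoluteGaloisGroup ℚ)} (h : V ≤ U)
    (hV : IsOpen (V : Set (absoluteGaloisGroup ℚ))) [Fintype (U ⧸ V.subgroupOf U)]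
    {x : H1 T V} (hx : x ∈ integralH1 T p V) :
    coresLe T.toTopRep h hV x ∈ integralH1 T p U := by
  rw [mem_integralH1_iff] at hx ⊢
  intro v hv 𝔓 h𝔓
  exact resLe_inertia_coresLe_eq_zero T.toTopRep h hV 𝔓 fun g _ ↦ hx v hv _ (smul_mem_primesAbove h𝔓 g⁻¹)

/-- **Corestriction preserves the integral classes (general case), over a number field `K`.**  For subgroups
`V ≤ U` of `Γ_K` with `V` open of finite index in `U` (no normality, no unramifiedness), `cor_{U/V}` maps
`H¹(O_{K_V}[1/p], T) = CM.integralH1K T p V` into `CM.integralH1K T p U` — the `K`-twin of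
`coresLe_mem_integralH1_of_le`, same proof (`smul_mem_primesAbove` over `K`). [cite: Kato2004Asterisque, §8.2, Lemma 8.5 (pp. 180–184) and §15.6 (p. 253)] -/
theorem coresLe_mem_integralH1K_of_le {K : Type} [Field K] (T : GaloisRep K A M) (p : ℕ)
    {V U : Subgroup (absoluteGaloisGroup K)} (h : V ≤ U)
    (hV : IsOpen (V : Set (absoluteGaloisGroup K))) [Fintype (U ⧸ V.subgroupOf U)]
    {x : H1 T V} (hx : x ∈ integralH1K T p V) :
    coresLe T.toTopRep h hV x ∈ integralH1K T p U := by
  rw [mem_integralH1K_iff] at hx ⊢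
  intro v hv 𝔓 h𝔓
  exact resLe_inertia_coresLe_eq_zero T.toTopRep h hV 𝔓 fun g _ ↦ hx v hv _ (smul_mem_primesAbove h𝔓 g⁻¹)

/-- The layer traces `Cor : H¹(K_{n+1}, T) → H¹(K_n, T)` of a `ℤ_p`-extension of a field `K` preserve the integral
classes — with NO hypothesis on the ramification of `K_{n+1}/K_n` (cf. `IwasawaCohomologyNumberField`, where the
carrier records integrality levelwise). [cite: Kato2004Asterisque, §8.2 and §12.2 (p. 220)] -/
theorem layerCoresOver_mem_integralH1K {K : Type} [Field K] (T : GaloisRep K A M) {p : ℕ} [Fact p.Prime]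
    (κ : ZpExtension K p) (n : ℕ) {x : H1 T (κ.layerSubgroup (n + 1))}
    (hx : x ∈ integralH1K T p (κ.layerSubgroup (n + 1))) :
    layerCoresOver T κ n x ∈ integralH1K T p (κ.layerSubgroup n) := by
  haveI : CompactSpace (absoluteGaloisGroup K) := absoluteGaloisGroup_compactSpace K
  haveI : (κ.layerSubgroup (n + 1)).FiniteIndex :=
    finiteIndex_of_isOpen_of_compactSpace _ (κ.isOpen_layerSubgroup (n + 1))
  letI : Fintype (κ.layerSubgroup n ⧸ (κ.layerSubgroup (n + 1)).subgroupOf (κ.layerSubgroup n)) :=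
    Fintype.ofFinite _
  rw [layerCoresOver_eq_coresLe]
  exact coresLe_mem_integralH1K_of_le T p _ _ hx

/-- The layer traces `Cor : H¹(ℚ_{n+1}, T) → H¹(ℚ_n, T)` of a `ℤ_p`-extension of `ℚ` preserve the integral classes,
with no hypothesis on ramification. [cite: Kato2004Asterisque, §8.2 and §12.2 (p. 220)] -/
theorem layerCores_mem_integralH1 (T : GaloisRep ℚ A M) {p : ℕ} [Fact p.Prime]
    (κ : ZpExtension ℚ p) (n : ℕ) {x : H1 T (κ.layerSubgroup (n + 1))}
    (hx : x ∈ integralH1 T p (κ.layerSubgroup (n + 1))) :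
    layerCores T κ n x ∈ integralH1 T p (κ.layerSubgroup n) := by
  haveI : (κ.layerSubgroup (n + 1)).FiniteIndex :=
    finiteIndex_of_isOpen_of_compactSpace _ (κ.isOpen_layerSubgroup (n + 1))
  letI : Fintype (κ.layerSubgroup n ⧸ (κ.layerSubgroup (n + 1)).subgroupOf (κ.layerSubgroup n)) :=
    Fintype.ofFinite _
  exact coresLe_mem_integralH1_of_le T p _ _ hx

end Integral

end Literature.NumberTheory.EllipticCurves.Kato2004

end
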